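import Literature.NumberTheory.NumberFields.EquivariantUnramifiedDescentOpen
import Literature.NumberTheory.GaloisRepresentations.InertiaLift
import Mathlib.NumberTheory.Padics.PadicIntegers
import HarnessLib

/-!
# Equivariant unramified descent, IV: the descent subgroup swallows the DECOMPOSITION groups
# (one layer up), total ramification from level `0` when `p ∤ [L : k]`, and lifting decomposition
# groups through a closed subgroup (door L5 of the cell `bsd-potss`: group-theoretic core)

Topic `NumberTheory/NumberFields` (namespace = path, grouping sub-namespace
`EquivariantUnramifiedDescent`).  THEOREM-ONLY file (no definition, no named fact, no `sorry`), sequel of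
`EquivariantUnramifiedDescent{,Open}.lean` (notation as there: `κ : Γ → ℤ_p`, `Λ₀ ⊴ Γ`,
`H′ = Λ₀ ∩ ker κ`, `Λ_m = Λ₀ ∩ κ⁻¹(pᵐℤ_p)`, `φ` additive `Γ`-equivariant on `H′`, `V` killed by `p` with
`Λ₀` acting trivially), written by the literature seat `bsd-potss-conjA-anchor` g18 (cell `bsd-potss`;
serves the asides stmt-BirchSwinnertonDyer-19386 / 19413; closes nothing; neither Coates–Sujatha's
Conjecture A nor BSD is proved for any curve here).

* `mem_descentSubgroup_of_forall_exists` — THE ONE-LAYER-UP TRICK FOR A DECOMPOSITION GROUP.  Let `Q`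
  be the descent subgroup at level `n + 1` (`Q = (I₀ ∩ Λ_{n+1}) · ker φ`, presented by its membership
  predicate as output by `exists_descentSubgroup` / `exists_equivariant_unramified_extension`), `I₀`
  being «totally ramified at level `n`» (`κ(I₀ ∩ Λ₀) ⊇ pⁿℤ_p`).  If a subgroup `D ≤ Γ` satisfies the SAME
  surjectivity `κ(D ∩ Λ₀) ⊇ pⁿℤ_p` and `φ` kills `D ∩ H′`, then `D ∩ Λ_{n+1} ≤ Q`: for `d ∈ D ∩ Λ_{n+1}`,
  `κ(d) = p·t`, `t = κ(y) = κ(y₀)` with `y ∈ D ∩ Λ₀`, `y₀ ∈ I₀ ∩ Λ₀`; then `yᵖ ≡ y₀ᵖ (mod ker φ)`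
  (commutator and `p`-th power corrections die: `Λ₀` acts trivially, `pV = 0`) and `(yᵖ)⁻¹d ∈ D ∩ H′`,
  so `d ∈ y₀ᵖ · ker φ ⊆ Q`.  In the arithmetic application (`Γ = Γ_k`, `D` = a decomposition group
  `D_𝔮`, `φ` = the shadow of a FINE Selmer class, which kills `D_𝔮 ∩ H′` at EVERY place): (a) for
  `𝔮 ∣ p` the hypothesis is total ramification of `𝔮` itself (`I_𝔮 ≤ D_𝔮`); (b) for `𝔮 ∤ p` it says
  `κ(D_𝔮 ∩ Λ₀) ⊇ pⁿℤ_p`, i.e. the prime of `L` below `𝔮` does NOT split completely in `L_{n+1} = L k_{n+1}`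
  (residue degree `≥ p` in `L_{n+1}/L`) — hypothesis (c3′) of the cell's door L5.  CONSEQUENCE: the
  extended character `ψ` (kernel `Q` on `Λ_{n+1}`) kills `D_𝔮 ∩ Λ_{n+1}`, so the class-group functional
  it induces at the layer `L_{n+1}` kills the CLASS of the prime below `𝔮` — with NO hypothesis of type
  (c3) «`V^{D_𝔮} = 0`».
* `forall_exists_mem_of_not_dvd_index` — Washington Lemma 13.3 with `e = 0`: if `Λ₀ ⊴ Γ` has finite
  index PRIME TO `p`, `κ(I_{i₀}) = ℤ_p` and the `p`-adic `I_i` are conjugates of `I_{i₀}`, then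
  `κ(I_i ∩ Λ₀) = ℤ_p` for every `p`-adic `i` (the index `m = [I_{i₀} : I_{i₀} ∩ Λ₀]` divides `[Γ : Λ₀]`,
  so it is a unit of `ℤ_p`): total ramification from level `0`, i.e. the hypothesis `hram` of the descent
  at EVERY level `n`.
* `exists_mul_mem_stabilizer_of_isClosed` — LIFTING DECOMPOSITION GROUPS (Neukirch I (9.4) / Serre I §7
  Prop. 22 (a), surjectivity half, for a closed subgroup of a profinite group): `Γ` profinite acting
  continuously on a discrete commutative ring `B`, `N ≤ Γ` closed, `𝔓 ⊂ B` prime; if `g ∈ Γ` stabilises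
  `𝔓 ∩ B^N` (for `N`-fixed `b`: `b ∈ 𝔓 ↔ g • b ∈ 𝔓`), then `g·n ∈ Stab_Γ(𝔓)` for some `n ∈ N`
  (transitivity of `N` on the primes above `𝔓 ∩ B^N`, Mathlib
  `Algebra.IsInvariant.exists_smul_of_under_eq_of_profinite`, exactly as in the tree's
  `Literature.NumberTheory.GaloisRepresentations.exists_mul_mul_mem_inertia`).

HONEST FRAMING: lemmas of group theory / commutative algebra; the cites record the printed arguments
they transcribe (Washington §13.1 Lemma 13.3, §13.3 Lemmas 13.14–13.15; Neukirch I §9).  The use made of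
them — Deo–Ray–Sujatha's criterion at a finite LAYER of the cyclotomic tower without the local
hypothesis (c3) at `p` — is the cell's («door L5», memo of the seat's generation g15), not in print.

## References

* L. C. Washington, *Introduction to Cyclotomic Fields*, 2nd ed., GTM 83 (1997), §13.1 Prop. 13.2 and
  Lemma 13.3; §13.3 Lemmas 13.14–13.15. [Washington1997]
* J. Neukirch, *Algebraic Number Theory* (1999), Ch. I §9 (9.1), (9.4)–(9.6). [NeukirchANT1999]
* J.-P. Serre, *Local Fields*, GTM 67 (1979), Ch. I §7 Prop. 22. [SerreLocalFields1979]
* J. Coates, R. Sujatha, *Fine Selmer groups of elliptic curves over `p`-adic Lie extensions*,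
  Math. Ann. 331 (2005), §3 Thm. 3.4. [CoatesSujatha2005]
-/

open scoped Pointwise

namespace Literature.NumberTheory.NumberFields

namespace EquivariantUnramifiedDescent

section Algebra

variable {Γ : Type*} [Group Γ] {p : ℕ} [hp : Fact p.Prime]

/-- An additive map on a subgroup sends `1` to `0`. [folklore] -/
private theorem map_one_eq_zero_of_mulD {V : Type*} [AddCommGroup V] (H : Subgroup Γ) (φ : Γ → V)
    (hφ : ∀ a ∈ H, ∀ b ∈ H, φ (a * b) = φ a + φ b) : φ 1 = 0 := by
  have h := hφ 1 H.one_mem 1 H.one_mem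
  rw [mul_one] at h
  exact left_eq_add.mp h

/-- An additive map on a subgroup sends inverses to negatives. [folklore] -/
private theorem map_inv_eq_neg_of_mulD {V : Type*} [AddCommGroup V] (H : Subgroup Γ) (φ : Γ → V)
    (hφ : ∀ a ∈ H, ∀ b ∈ H, φ (a * b) = φ a + φ b) {a : Γ} (ha : a ∈ H) : φ a⁻¹ = -φ a := by
  have h := hφ a⁻¹ (H.inv_mem ha) a ha
  rw [inv_mul_cancel, map_one_eq_zero_of_mulD H φ hφ] at h
  exact (neg_eq_of_add_eq_zero_left h.symm).symm

/-- An additive map on a subgroup sends `a ^ m` to `m • φ a`. [folklore] -/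
private theorem map_pow_eq_nsmul_of_mulD {V : Type*} [AddCommGroup V] (H : Subgroup Γ) (φ : Γ → V)
    (hφ : ∀ a ∈ H, ∀ b ∈ H, φ (a * b) = φ a + φ b) {a : Γ} (ha : a ∈ H) (m : ℕ) :
    φ (a ^ m) = m • φ a := by
  induction m with
  | zero => rw [pow_zero, zero_smul, map_one_eq_zero_of_mulD H φ hφ]
  | succ m ih => rw [pow_succ, hφ _ (H.pow_mem ha m) a ha, ih, succ_nsmul]

/-- The kernel `{x ∈ H′ : φ x = 0}` of an additive, `Γ`-equivariant map on a conjugation-stable subgroup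
`H′` is a normal subgroup of `Γ` (presented by its membership predicate). [folklore] -/
private theorem exists_kernelSubgroupD {V : Type*} [AddCommGroup V] [DistribMulAction Γ V]
    (H : Subgroup Γ) (hHn : ∀ (g : Γ), ∀ x ∈ H, g * x * g⁻¹ ∈ H) (φ : Γ → V)
    (hφ : ∀ a ∈ H, ∀ b ∈ H, φ (a * b) = φ a + φ b)
    (hφ_equiv : ∀ (g : Γ), ∀ τ ∈ H, φ (g * τ * g⁻¹) = g • φ τ) :
    ∃ K : Subgroup Γ, K.Normal ∧ ∀ x, x ∈ K ↔ x ∈ H ∧ φ x = 0 := by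
  refine ⟨{ carrier := {x | x ∈ H ∧ φ x = 0}
            mul_mem' := fun {a b} ha hb => ⟨H.mul_mem ha.1 hb.1, by
              rw [hφ a ha.1 b hb.1, ha.2, hb.2, add_zero]⟩
            one_mem' := ⟨H.one_mem, map_one_eq_zero_of_mulD H φ hφ⟩
            inv_mem' := fun {a} ha => ⟨H.inv_mem ha.1, by
              rw [map_inv_eq_neg_of_mulD H φ hφ ha.1, ha.2, neg_zero]⟩ }, ⟨fun x hx g => ?_⟩,
    fun x => Iff.rfl⟩
  exact ⟨hHn g x hx.1, by rw [hφ_equiv g x hx.1, hx.2, smul_zero]⟩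

/-- **The descent subgroup swallows every «totally ramified» subgroup one layer up** (in particular the
decomposition groups above `p`, and the decomposition groups at primes whose residue degree in
`L_{n+1}/L` is `≥ p`).  Notation of the module docstring; `Q` is any subgroup with the membership
predicate of the descent subgroup `(I₀ ∩ Λ_{n+1}) · ker φ` output by `exists_descentSubgroup` (there
`I₀ = I_{i₀}`), `I₀` totally ramified at level `n` (`κ(I₀ ∩ Λ₀) ⊇ pⁿℤ_p`).  If `D ≤ Γ` has
`κ(D ∩ Λ₀) ⊇ pⁿℤ_p` and `φ` kills `D ∩ H′`, then `D ∩ Λ_{n+1} ≤ Q`.  PROOF («one layer up», Washington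
§13.3 with `pV = 0`): for `d ∈ D ∩ Λ_{n+1}` write `κ(d) = p·t` (`pⁿ ∣ t`), pick `y ∈ D ∩ Λ₀` and
`y₀ ∈ I₀ ∩ Λ₀` with `κ(y) = κ(y₀) = t`; then `h′ = y₀⁻¹y ∈ H′` commutes with `y₀` modulo `ker φ`
(equivariance, `Λ₀` acts trivially) and `h′ᵖ ∈ ker φ` (`pV = 0`), so `yᵖ ≡ y₀ᵖ (mod ker φ)`; and
`(yᵖ)⁻¹ d ∈ D ∩ H′ ⊆ ker φ`.  Hence `d = y₀ᵖ · k` with `k ∈ ker φ`, `y₀ᵖ ∈ I₀ ∩ Λ_{n+1}`.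
[cite: Washington1997, §13.3 Lemmas 13.14–13.15 (the elements `σ_iσ_1⁻¹`; here `p`-th powers), §13.1 Prop. 13.2]
[cite: NeukirchANT1999, Ch. I §9 (9.6) (inertia inside decomposition)] -/
theorem mem_descentSubgroup_of_forall_exists (κ : Γ →* Multiplicative ℤ_[p]) (Λ₀ : Subgroup Γ)
    [hΛ₀ : Λ₀.Normal] (H' : Subgroup Γ) (hH' : ∀ σ, σ ∈ H' ↔ σ ∈ Λ₀ ∧ κ σ = 1)
    (Λ : ℕ → Subgroup Γ) (hΛ : ∀ m σ, σ ∈ Λ m ↔ σ ∈ Λ₀ ∧ (p : ℤ_[p]) ^ m ∣ (κ σ).toAdd)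
    {V : Type*} [AddCommGroup V] [DistribMulAction Γ V]
    (hpV : ∀ v : V, p • v = 0) (htriv : ∀ σ ∈ Λ₀, ∀ v : V, σ • v = v)
    (I₀ : Subgroup Γ) (n : ℕ)
    (hram₀ : ∀ t : ℤ_[p], (p : ℤ_[p]) ^ n ∣ t → ∃ y ∈ I₀, y ∈ Λ₀ ∧ (κ y).toAdd = t)
    (φ : Γ → V) (hφ_mul : ∀ a ∈ H', ∀ b ∈ H', φ (a * b) = φ a + φ b)
    (hφ_equiv : ∀ (g : Γ), ∀ τ ∈ H', φ (g * τ * g⁻¹) = g • φ τ)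
    (Q : Subgroup Γ)
    (hQ : ∀ x, x ∈ Q ↔ ∃ y ∈ I₀, ∃ k ∈ H', y ∈ Λ (n + 1) ∧ φ k = 0 ∧ y * k = x)
    (D : Subgroup Γ)
    (hD : ∀ t : ℤ_[p], (p : ℤ_[p]) ^ n ∣ t → ∃ y ∈ D, y ∈ Λ₀ ∧ (κ y).toAdd = t)
    (hφ_D : ∀ τ ∈ D, τ ∈ H' → φ τ = 0) :
    ∀ x ∈ D, x ∈ Λ (n + 1) → x ∈ Q := by
  classical
  intro x hxD hxΛ
  -- ### bookkeeping
  have hκconj : ∀ g z : Γ, κ (g * z * g⁻¹) = κ z := fun g z => by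
    rw [map_mul, map_mul, map_inv, mul_comm (κ g) (κ z), mul_assoc, mul_inv_cancel, mul_one]
  have hH'n : ∀ (g : Γ), ∀ z ∈ H', g * z * g⁻¹ ∈ H' := fun g z hz => by
    rw [hH'] at hz ⊢
    exact ⟨hΛ₀.conj_mem z hz.1 g, by rw [hκconj, hz.2]⟩
  have hΛ₀_of : ∀ m, ∀ z ∈ Λ m, z ∈ Λ₀ := fun m z hz => ((hΛ m z).1 hz).1
  have hmemH' : ∀ z, z ∈ Λ₀ → κ z = 1 → z ∈ H' := fun z h1 h2 => (hH' z).2 ⟨h1, h2⟩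
  have hφ_inv : ∀ a ∈ H', φ a⁻¹ = -φ a := fun a ha => map_inv_eq_neg_of_mulD H' φ hφ_mul ha
  -- ### the kernel `K = {z ∈ H′ : φ z = 0}`, a normal subgroup of `Γ`
  obtain ⟨K, hKn, hK⟩ := exists_kernelSubgroupD H' hH'n φ hφ_mul hφ_equiv
  haveI := hKn
  have hKH' : K ≤ H' := fun z hz => ((hK z).1 hz).1
  -- ### `κ x = p · t` with `pⁿ ∣ t`
  obtain ⟨t, htn, htx⟩ : ∃ t : ℤ_[p], (p : ℤ_[p]) ^ n ∣ t ∧ (κ x).toAdd = (p : ℤ_[p]) * t := by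
    obtain ⟨s, hs⟩ := ((hΛ (n + 1) x).1 hxΛ).2
    exact ⟨(p : ℤ_[p]) ^ n * s, dvd_mul_right _ _, by rw [hs, pow_succ]; ring⟩
  have hpow : ∀ y : Γ, ∀ s : ℤ_[p], (κ y).toAdd = s → (κ (y ^ p)).toAdd = (p : ℤ_[p]) * s :=
    fun y s hy => by rw [map_pow, toAdd_pow, hy, nsmul_eq_mul]
  -- ### `y ∈ D ∩ Λ₀`, `y₀ ∈ I₀ ∩ Λ₀` with `κ y = κ y₀ = t`
  obtain ⟨y, hyD, hyΛ₀, hyt⟩ := hD t htn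
  obtain ⟨y₀, hy₀I, hy₀Λ₀, hy₀t⟩ := hram₀ t htn
  have hyp : κ (y ^ p) = κ x := Multiplicative.toAdd.injective (by rw [hpow y t hyt, htx])
  have hy₀p : κ (y₀ ^ p) = κ x := Multiplicative.toAdd.injective (by rw [hpow y₀ t hy₀t, htx])
  have hxΛ₀ : x ∈ Λ₀ := hΛ₀_of _ x hxΛ
  -- ### `h = (y^p)⁻¹ x ∈ D ∩ H′`, so `φ h = 0`, `h ∈ K`
  have hh : (y ^ p)⁻¹ * x ∈ K := by
    rw [hK]
    have hhH' : (y ^ p)⁻¹ * x ∈ H' := hmemH' _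
      (Λ₀.mul_mem (Λ₀.inv_mem (Λ₀.pow_mem hyΛ₀ p)) hxΛ₀)
      (by rw [map_mul, map_inv, hyp, inv_mul_cancel])
    exact ⟨hhH', hφ_D _ (D.mul_mem (D.inv_mem (D.pow_mem hyD p)) hxD) hhH'⟩
  -- ### `h' = y₀⁻¹ y ∈ H′` commutes with `y₀` modulo `K`, and `h'^p ∈ K`
  have hh'H' : y₀⁻¹ * y ∈ H' := hmemH' _ (Λ₀.mul_mem (Λ₀.inv_mem hy₀Λ₀) hyΛ₀)
    (Multiplicative.toAdd.injective (by
      rw [map_mul, map_inv, toAdd_mul, toAdd_inv, hyt, hy₀t, neg_add_cancel, toAdd_one]))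
  have hcommK : (y₀ * (y₀⁻¹ * y))⁻¹ * ((y₀⁻¹ * y) * y₀) ∈ K := by
    rw [hK]
    have e : (y₀ * (y₀⁻¹ * y))⁻¹ * ((y₀⁻¹ * y) * y₀) =
        (y₀⁻¹ * y)⁻¹ * (y₀⁻¹ * (y₀⁻¹ * y) * y₀⁻¹⁻¹) := by group
    have h2 : y₀⁻¹ * (y₀⁻¹ * y) * y₀⁻¹⁻¹ ∈ H' := hH'n y₀⁻¹ _ hh'H'
    rw [e]
    refine ⟨H'.mul_mem (H'.inv_mem hh'H') h2, ?_⟩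
    rw [hφ_mul _ (H'.inv_mem hh'H') _ h2, hφ_equiv y₀⁻¹ _ hh'H', hφ_inv _ hh'H',
      htriv y₀⁻¹ (Λ₀.inv_mem hy₀Λ₀), neg_add_cancel]
  have hcomm : Commute (QuotientGroup.mk y₀ : Γ ⧸ K) (QuotientGroup.mk (y₀⁻¹ * y)) := by
    change (QuotientGroup.mk y₀ : Γ ⧸ K) * QuotientGroup.mk (y₀⁻¹ * y) =
      QuotientGroup.mk (y₀⁻¹ * y) * QuotientGroup.mk y₀
    rw [← QuotientGroup.mk_mul, ← QuotientGroup.mk_mul]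
    exact QuotientGroup.eq.2 hcommK
  have hh'p : (y₀⁻¹ * y) ^ p ∈ K := by
    rw [hK]
    exact ⟨H'.pow_mem hh'H' p, by rw [map_pow_eq_nsmul_of_mulD H' φ hφ_mul hh'H' p, hpV]⟩
  -- ### hence `y^p ≡ y₀^p (mod K)`
  have hyy₀ : (y₀ ^ p)⁻¹ * y ^ p ∈ K := by
    rw [← QuotientGroup.eq]
    have ey : y = y₀ * (y₀⁻¹ * y) := by group
    conv_rhs => rw [ey]
    rw [QuotientGroup.mk_pow, QuotientGroup.mk_pow, QuotientGroup.mk_mul, hcomm.mul_pow,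
      ← QuotientGroup.mk_pow K (y₀⁻¹ * y) p, (QuotientGroup.eq_one_iff _).2 hh'p, mul_one]
  -- ### `x = y₀^p · k` with `k ∈ K`, `y₀^p ∈ I₀ ∩ Λ_{n+1}`
  have hk : (y₀ ^ p)⁻¹ * y ^ p * ((y ^ p)⁻¹ * x) ∈ K := K.mul_mem hyy₀ hh
  rw [hQ]
  refine ⟨y₀ ^ p, I₀.pow_mem hy₀I p, (y₀ ^ p)⁻¹ * y ^ p * ((y ^ p)⁻¹ * x), hKH' hk, ?_,
    ((hK _).1 hk).2, by group⟩
  exact (hΛ _ _).2 ⟨Λ₀.pow_mem hy₀Λ₀ p, by rw [hy₀p]; exact ((hΛ (n + 1) x).1 hxΛ).2⟩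

/-- **Total ramification from level `0` when `p ∤ [Γ : Λ₀]`** (Washington Lemma 13.3 with `e = 0`):
if `Λ₀ ⊴ Γ` has finite index prime to `p`, `κ(I_{i₀}) = ℤ_p` and every `p`-adic `I_i` is a conjugate of
`I_{i₀}`, then `κ(I_i ∩ Λ₀) = ℤ_p` for every `p`-adic `i`; stated in the shape of the hypothesis `hram`
of `exists_descentSubgroup` (at every level `n`).  The index `m = [I_{i₀} : I_{i₀} ∩ Λ₀]` divides
`[Γ : Λ₀]`, so it is a unit of `ℤ_p`, and `y ↦ yᵐ` maps `I_{i₀}` into `Λ₀`.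
[cite: Washington1997, §13.1 Lemma 13.3 (proof)] -/
theorem forall_exists_mem_of_not_dvd_index (κ : Γ →* Multiplicative ℤ_[p]) (Λ₀ : Subgroup Γ)
    [Λ₀.Normal] [Λ₀.FiniteIndex] (hpdvd : ¬ p ∣ Λ₀.index)
    {ι : Type*} (I : ι → Subgroup Γ) (pAdic : ι → Prop) (i₀ : ι)
    (htrans : ∀ i, pAdic i → ∃ g : Γ, ∀ x, x ∈ I i ↔ g⁻¹ * x * g ∈ I i₀)
    (hsurj : ∀ t : ℤ_[p], ∃ y ∈ I i₀, (κ y).toAdd = t) :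
    ∀ (n : ℕ) (i : ι), pAdic i → ∀ t : ℤ_[p], (p : ℤ_[p]) ^ n ∣ t →
      ∃ y ∈ I i, y ∈ Λ₀ ∧ (κ y).toAdd = t := by
  classical
  have hpr : p.Prime := Fact.out
  -- the index `m` of `Λ₀ ∩ I_{i₀}` in `I_{i₀}` is prime to `p` and kills `I_{i₀}` into `Λ₀`
  set m : ℕ := Λ₀.relIndex (I i₀) with hm
  have hmdvd : m ∣ Λ₀.index := Subgroup.relIndex_dvd_index_of_normal Λ₀ (I i₀)
  have hpm : ¬ p ∣ m := fun h => hpdvd (h.trans hmdvd)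
  have hpow : ∀ y ∈ I i₀, y ^ m ∈ Λ₀ := fun y hy => Subgroup.pow_relIndex_mem Λ₀ hy
  -- `m` is a unit of `ℤ_p`
  have hunit : IsUnit (m : ℤ_[p]) := by
    rw [PadicInt.isUnit_iff, PadicInt.norm_natCast_eq_one_iff]
    exact (Nat.Prime.coprime_iff_not_dvd hpr).mpr hpm
  obtain ⟨u, hu⟩ := hunit
  intro n i hi t _
  -- first for `i₀`: every `t` is `κ` of an element of `I_{i₀} ∩ Λ₀`
  have base : ∀ s : ℤ_[p], ∃ y ∈ I i₀, y ∈ Λ₀ ∧ (κ y).toAdd = s := by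
    intro s
    obtain ⟨y, hy, hys⟩ := hsurj (((u⁻¹ : ℤ_[p]ˣ) : ℤ_[p]) * s)
    refine ⟨y ^ m, (I i₀).pow_mem hy m, hpow y hy, ?_⟩
    rw [map_pow, toAdd_pow, hys, nsmul_eq_mul, ← hu, ← mul_assoc, Units.mul_inv, one_mul]
  -- then transport by conjugation to any `p`-adic `i`
  obtain ⟨y₀, hy₀I, hy₀Λ, hy₀t⟩ := base t
  obtain ⟨g, hg⟩ := htrans i hi
  refine ⟨g * y₀ * g⁻¹, (hg _).2 ?_, Subgroup.Normal.conj_mem inferInstance y₀ hy₀Λ g, ?_⟩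
  · have : g⁻¹ * (g * y₀ * g⁻¹) * g = y₀ := by group
    rw [this]; exact hy₀I
  · have hc : κ (g * y₀ * g⁻¹) = κ y₀ := by
      rw [map_mul, map_mul, map_inv, mul_comm (κ g) (κ y₀), mul_assoc, mul_inv_cancel, mul_one]
    rw [hc, hy₀t]

end Algebra

section Profinite

variable {B : Type*} [CommRing B] {Γ : Type*} [Group Γ] [MulSemiringAction Γ B]
  [TopologicalSpace Γ] [CompactSpace Γ] [TotallyDisconnectedSpace Γ] [IsTopologicalGroup Γ]
  [TopologicalSpace B] [DiscreteTopology B] [ContinuousSMul Γ B]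

/-- **Lifting decomposition groups through a closed subgroup.**  Let the profinite group `Γ` act
continuously on the discrete commutative ring `B`, let `N ≤ Γ` be closed and `𝔓 ⊂ B` prime.  If `g ∈ Γ`
stabilises the prime `𝔓 ∩ B^N` of the ring of `N`-invariants (for every `N`-fixed `b`:
`b ∈ 𝔓 ↔ g • b ∈ 𝔓`), then `g · n` stabilises `𝔓` for some `n ∈ N`.  Equivalently: the decomposition
group `Stab_Γ(𝔓)` SURJECTS onto the decomposition group of `𝔓 ∩ B^N` at the level of the invariants
(Neukirch I (9.4) / Serre I §7 Prop. 22 (a), the surjectivity half; proof: `g⁻¹𝔓` and `𝔓` contract to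
the same prime of `B^N`, and `N` is transitive on the primes above it — Mathlib
`Algebra.IsInvariant.exists_smul_of_under_eq_of_profinite`, as in the tree's
`Literature.NumberTheory.GaloisRepresentations.exists_mul_mul_mem_inertia`).
[cite: NeukirchANT1999, Ch. I §9 Prop. (9.1) and (9.4)] [cite: SerreLocalFields1979, Ch. I §7 Prop. 22(a)] -/
theorem exists_mul_mem_stabilizer_of_isClosed (N : Subgroup Γ) (hN : IsClosed (N : Set Γ))
    (𝔓 : Ideal B) [𝔓.IsPrime] (g : Γ)
    (hg : ∀ b : B, (∀ n ∈ N, n • b = b) → (b ∈ 𝔓 ↔ g • b ∈ 𝔓)) :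
    ∃ n ∈ N, g * n ∈ MulAction.stabilizer Γ 𝔓 := by
  classical
  -- the ring of `N`-invariants and the profinite structure on `N`
  let A : Subring B := FixedPoints.subring B N
  haveI : Algebra.IsInvariant A B N :=
    Literature.NumberTheory.GaloisRepresentations.isInvariant_fixedPointsSubring N
  haveI : CompactSpace N := isCompact_iff_compactSpace.mp hN.isCompact
  have hfix : ∀ a : A, ∀ n ∈ N, n • (a : B) = a := fun a n hn ↦ a.2 ⟨n, hn⟩
  -- `g⁻¹ • 𝔓` and `𝔓` lie over the same prime of `A`
  have hunder : 𝔓.under A = (g⁻¹ • 𝔓).under A := by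
    ext a
    simp only [Ideal.under, Ideal.mem_comap]
    rw [Ideal.mem_inv_pointwise_smul_iff]
    exact hg a (hfix a)
  obtain ⟨n₁, hn₁⟩ :=
    Algebra.IsInvariant.exists_smul_of_under_eq_of_profinite (A := A) (G := N) 𝔓 (g⁻¹ • 𝔓) hunder
  have hn₁' : (g⁻¹ • 𝔓 : Ideal B) = ((n₁ : Γ) • 𝔓 : Ideal B) := hn₁
  refine ⟨(n₁ : Γ), n₁.2, ?_⟩
  rw [MulAction.mem_stabilizer_iff, mul_smul, ← hn₁', smul_inv_smul]

end Profinite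

end EquivariantUnramifiedDescent

end Literature.NumberTheory.NumberFields
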